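import Summits.ResolutionOfSingularities.ResolutionOfSingularities.Theorems.EquisingularLiftEquisingularLiftNatClusterStepDefs
import Summits.ResolutionOfSingularities.ResolutionOfSingularities.Theorems.EquisingularLiftEquisingularLiftNatClusterLiftSurj
import Mathlib
import HarnessLib

/-!
# [OURS · L1 W4.5(b) · EL♮(3)] The NON-SUPERABUNDANCE clause of rung v7′ (TC⁺⁺) DISCHARGED: numerically (`Σ m_t ≤ dg + 1`) and as a
# surjectivity — bridges from the registered vocabulary `ClusterNonSuperabundant` / `FatCluster` (…NatClusterStepDefs, p531557) to the
# T-CLUSTER-LIFT series (crux `EquisingularLiftNat` = stmt-ResolutionOfSingularities-20038 / child stmt-…-20148, line `sections`)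

NOT a statement of any manuscript. Helper file of the chain res-L1-w45b (cell `res-hironaka`, LADDER-RESOLUTION rung L, slot
W4.5(b)); OURS; AI-written, weaker than expert review; `--supports stmt-ResolutionOfSingularities-20038 --as helper` by
res-L1-w45b-stub-3 (res-L1-w45b-lead-2 GO 2026-08-27T12:38:53Z «your numerical discharge `clusterNonSuperabundant_of_sum_le` over
p527698: GO once p531557 lands»). No `sorry`; standard axioms.

* **`clusterNonSuperabundant_of_sum_le`** — pairwise distinct points of `ℙ²` (the DISTINCT clause of `FatCluster`) with
  `Σ_t m t ≤ dg + 1` are non-superabundant (T-CLUSTER-LIFT part 5 `exists_isHomogeneous_forall_coeff_eq_charts`, p527698: «fat points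
  impose independent conditions in degree `≥ Σ m_t − 1`»); `clusterNonSuperabundant_of_fatCluster_of_sum_le` reads the DISTINCT clause
  off a `FatCluster`. So on a specimen the clause (b) of `CarrierCluster` is settled by ONE inequality (every two-point cluster of a
  reduced curve; three double points on a sextic; F₇⁻ with `Σ m = 21 > 8` is NOT covered — there the clause is the genuine rank
  condition).
* `clusterNonSuperabundant_iff_quotient_surjective` — the clause as the surjectivity of `k'[T]_{dg} → Π_t k'[U] ⧸ 𝔪_{a t}^{m t}`
  (T-CLUSTER-LIFT part 6 `hind_iff_quotient_surjective`, p528441), the «`H⁰(𝒪_e(dg)) → ⊕ 𝒪_{e,q_t}/𝔪^{m t}` onto» reading.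
* `clusterNonSuperabundant_mono` — the clause for the full cluster gives the jet clause for the sub-cluster on any subset `S ⊆ Fin s`
  (index `↥S`, the form the T-CLUSTER-LIFT theorems consume; the supplier's members are indexed by subsets).

References: …NatClusterStepDefs (res-L1-w45b-lead-2, p531557); T-CLUSTER-LIFT parts 5/6 (p527698, p528441). res-L1-w45b-lead-2 12:38:53Z
(OURS planning text, index only).
-/

set_option linter.dupNamespace false -- mandated namespace `Summit.<Summit>.<Problem>` of this single-conjunct summit

noncomputable section

open MvPolynomial Literature.AlgebraicGeometry.Resolution
open Summit.ResolutionOfSingularities.ResolutionOfSingularities.Theorems.EquisingularLiftNat.ClusterLift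

namespace Summit.ResolutionOfSingularities.ResolutionOfSingularities.Cruxes.EquisingularLiftNat.Sections

variable {k' : Type} [Field k'] {dg s : ℕ}

/-- **NUMERICAL DISCHARGE of the v7′ clause (b).** Pairwise distinct points of `ℙ²_{k'}` (each on its chart `i t` with affine coordinates
`a t`) with `Σ_t m t ≤ dg + 1` are NON-SUPERABUNDANT for degree-`dg` forms. (T-CLUSTER-LIFT part 5, p527698.) [OURS · L1 W4.5b] -/
theorem clusterNonSuperabundant_of_sum_le (i : Fin s → Fin 3) (a : (t : Fin s) → {j : Fin 3 // j ≠ i t} → k') (m : Fin s → ℕ)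
    (hdist : ∀ t t', t ≠ t' → ¬ ∃ r : k', (fun l : Fin 3 => if h : l = i t' then (1 : k') else a t' ⟨l, h⟩) =
      r • (fun l : Fin 3 => if h : l = i t then (1 : k') else a t ⟨l, h⟩))
    (hd : ∑ t, m t ≤ dg + 1) : ClusterNonSuperabundant dg s i a m :=
  fun v => exists_isHomogeneous_forall_coeff_eq_charts i a hdist m hd v

/-- **The DISTINCT clause of a `FatCluster` plus `Σ m t ≤ dg + 1` gives non-superabundance.** [OURS · L1 W4.5b] -/
theorem clusterNonSuperabundant_of_fatCluster_of_sum_le {g : MvPolynomial (Fin 3) k'} {i : Fin s → Fin 3}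
    {a : (t : Fin s) → {j : Fin 3 // j ≠ i t} → k'} {m : Fin s → ℕ} (hF : FatCluster g s i a m)
    (hd : ∑ t, m t ≤ dg + 1) : ClusterNonSuperabundant dg s i a m :=
  clusterNonSuperabundant_of_sum_le i a m hF.2.1 hd

/-- **The clause (b) as a surjectivity** onto the product of the local jet rings `Π_t k'[U] ⧸ 𝔪_{a t}^{m t}` («`H⁰(𝒪_e(dg)) → ⊕_t 𝒪_{e,q_t}/𝔪^{m t}`
onto»; T-CLUSTER-LIFT part 6, p528441). [OURS · L1 W4.5b] -/
theorem clusterNonSuperabundant_iff_quotient_surjective (i : Fin s → Fin 3) (a : (t : Fin s) → {j : Fin 3 // j ≠ i t} → k')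
    (m : Fin s → ℕ) :
    ClusterNonSuperabundant dg s i a m ↔
      ∀ c : (t : Fin s) → MvPolynomial {j : Fin 3 // j ≠ i t} k' ⧸
          (Ideal.span (Set.range fun j => (X j : MvPolynomial {j : Fin 3 // j ≠ i t} k') - C (a t j))) ^ m t,
        ∃ g : MvPolynomial (Fin 3) k', g.IsHomogeneous dg ∧ ∀ t,
          Ideal.Quotient.mk ((Ideal.span (Set.range fun j => (X j : MvPolynomial {j : Fin 3 // j ≠ i t} k') - C (a t j))) ^ m t)
            (dehomogenize (i t) g) = c t :=
  hind_iff_quotient_surjective i a m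

/-- **Sub-clusters inherit non-superabundance.** If the full cluster `(i, a, m)` is non-superabundant then so is the sub-cluster on any
subset `S ⊆ Fin s`, in the general-index form consumed by the T-CLUSTER-LIFT theorems (`ι := ↥S`; prescribe the jets on `S`, zero
elsewhere) — the supplier's members are indexed by subsets of the cluster. [OURS · L1 W4.5b] -/
theorem clusterNonSuperabundant_mono (S : Set (Fin s)) (i : Fin s → Fin 3)
    (a : (t : Fin s) → {j : Fin 3 // j ≠ i t} → k') (m : Fin s → ℕ) (h : ClusterNonSuperabundant dg s i a m)
    (v : (t : S) → ({j : Fin 3 // j ≠ i t.1} →₀ ℕ) → k') :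
    ∃ g' : MvPolynomial (Fin 3) k', g'.IsHomogeneous dg ∧ ∀ (t : S) (α : {j : Fin 3 // j ≠ i t.1} →₀ ℕ), α.degree < m t.1 →
      coeff α (aeval (fun j => (X j : MvPolynomial {j : Fin 3 // j ≠ i t.1} k') + C (a t.1 j)) (dehomogenize (i t.1) g')) = v t α := by
  classical
  obtain ⟨g, hg, hjet⟩ := h fun t α => if ht : t ∈ S then v ⟨t, ht⟩ α else 0
  refine ⟨g, hg, fun t α hα => ?_⟩
  rw [hjet t.1 α hα, dif_pos t.2]

end Summit.ResolutionOfSingularities.ResolutionOfSingularities.Cruxes.EquisingularLiftNat.Sections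

end
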